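import Summits.CriticalPhenomena.PercolationContinuityZ3.Theorems.SahiRandomClusterLimits

/-!
# The cross box condition for random-cluster measures with `(p, W) ≤ (p', W')` (`q ≥ 1`): Holley's condition for the
# weights from the cross supermodularity of the wired cluster counts

Support file of the Sahi cell (`prim-sahi`, typer seat, generation 16; `--supports stmt-CriticalPhenomena-4575`).
Theorems only (no definitions, no named facts, no sorries).  First half of the random-cluster companion of generation
15's `SahiIsingCrossBox.lean`; the second half (`SahiRandomClusterOrdering.lean`) passes to the infinite-volume limits
`φ^b_{p,q}` of `ℤ^d` and derives the stochastic ordering for all measurable increasing functionals.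

* `clusterCount_cross` (+ `clusterCount_anti`) — **cross supermodularity of the wired cluster counts**: for `W ⊆ W'`,
  `k^W(a) + k^{W'}(b) ≤ k^W(a ∩ b) + k^{W'}(a ∪ b)` (the tree's `card_connectedComponent_supermodular` [Grimmett 2006,
  (3.12)] applied to `G_a ∨ K_W`, `G_b ∨ K_{W'}`, plus antitonicity of the number of components).
* `rcWeight_cross_condition` — **Holley's condition for random-cluster weights with `(p, W) ≤ (p', W')`** (`q ≥ 1`):
  `w^W_p(a) w^{W'}_{p'}(b) ≤ w^W_p(a ∩ b) w^{W'}_{p'}(a ∪ b)` (the `p`-part is `(p(1−p'))^k ≤ ((1−p)p')^k`,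
  `k = |a ∖ b|`).
* `rcWeight_cross_condition_q` — the same at `q ≤ q'` (same `p`, same wiring): `w_{q'}(a) w_q(b) ≤ w_{q'}(a ∩ b) w_q(a ∪ b)`
  (supermodularity and antitonicity of the cluster count), i.e. `φ_{p,q'}` lies BELOW `φ_{p,q}`.
* `rcMeasure_real_mul_le_of_cross`, **`crossBox_rcMeasure(_of_cross/_q)`**, **`crossBox_rcLaw(_of_cross/_q)`** — the two-measure lattice inequality for
  events and the CROSS BOX CONDITION `φ₁[a,b] φ₂[a',b'] ≤ φ₁[a ∩ a', b ∩ b'] φ₂[a ∪ a', b ∪ b']` for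
  `φ₁ = φ^W_{G,p,q}`, `φ₂ = φ^{W'}_{G,p',q}` (four functions theorem), on any finite graph and for the finite-region
  measures of `ℤ^d` read on the lattice; `RCBoundary.wiredSet_free_subset` (free ≤ any ≤ wired).

In print the consequences (`φ^W_{p,q} ≤_st φ^{W'}_{p',q}` for increasing functions) are Grimmett 2006, Thm. 3.21 /
Lemma 4.14 / (4.21) via Holley's theorem for positive weights; the cross box formulation is this work.

No sorries, no new axioms.
-/

noncomputable section

namespace Summit.CriticalPhenomena.PercolationContinuityZ3.Theorems.SahiBoxTP2

open MeasureTheory Set Filter Topology Function Finset SimpleGraph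
open Literature.Probability.LatticeModels Literature.Probability.Percolation
open scoped ENNReal

/-! ### Cross supermodularity of the wired cluster counts -/

section Graph

variable {V : Type*}

/-- **Cross supermodularity of the cluster counts** (`W ⊆ W'`, finite vertex set):
`k^W(a) + k^{W'}(b) ≤ k^W(a ∩ b) + k^{W'}(a ∪ b)`. [this work; cite: Grimmett2006, Thm. 3.8, eq. (3.12) (the case
`W = W'`)] -/
theorem clusterCount_cross [Finite V] (a b : BondConfig V) {W W' : Set V} (hW : W ⊆ W') :
    clusterCount a W + clusterCount b W' ≤ clusterCount (a ∩ b) W + clusterCount (a ∪ b) W' := by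
  unfold clusterCount Literature.Probability.Percolation.openGraph
  set A := fromEdgeSet a ⊔ wired W with hA
  set B := fromEdgeSet b ⊔ wired W' with hB
  -- wiring more vertices adds edges (the tree's `wired_mono` of `FKIsingAnnulusCrossingProofs`, inlined)
  have hwired : wired W ≤ wired W' := fun x y hxy => by
    rw [wired_adj] at hxy ⊢
    exact ⟨hxy.1, hW hxy.2.1, hW hxy.2.2⟩
  have h1 : fromEdgeSet (a ∩ b) ⊔ wired W ≤ A ⊓ B :=
    le_inf (sup_le_sup_right (fromEdgeSet_mono inter_subset_left) _)
      (sup_le_sup (fromEdgeSet_mono inter_subset_right) hwired)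
  have h2 : fromEdgeSet (a ∪ b) ⊔ wired W' ≤ A ⊔ B := by
    rw [fromEdgeSet_union]
    exact sup_le (sup_le_sup le_sup_left le_sup_left) (le_sup_right.trans le_sup_right)
  calc Nat.card A.ConnectedComponent + Nat.card B.ConnectedComponent
      ≤ Nat.card (A ⊓ B).ConnectedComponent + Nat.card (A ⊔ B).ConnectedComponent :=
        card_connectedComponent_supermodular A B
    _ ≤ _ := add_le_add (ConnectedComponent.card_le_card_of_le h1) (ConnectedComponent.card_le_card_of_le h2)

/-- The wired cluster count is antitone in the configuration. [folklore] -/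
theorem clusterCount_anti [Finite V] {a b : BondConfig V} (h : a ⊆ b) (W : Set V) :
    clusterCount b W ≤ clusterCount a W := by
  unfold clusterCount Literature.Probability.Percolation.openGraph
  exact ConnectedComponent.card_le_card_of_le (sup_le_sup_right (fromEdgeSet_mono h) _)

end Graph

/-! ### Holley's condition for random-cluster weights with `(p, W) ≤ (p', W')` -/

section Weights

variable {V : Type*} [Fintype V] [DecidableEq V] (G : SimpleGraph V) [DecidableRel G.Adj]

/-- **Holley's condition for the random-cluster weights** (`0 ≤ p ≤ p' ≤ 1`, `q ≥ 1`, `W ⊆ W'`; weights extended by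
`0` off the edge sets of `G`): `w^W_p(a) w^{W'}_{p'}(b) ≤ w^W_p(a ∩ b) w^{W'}_{p'}(a ∪ b)`. [this work] -/
theorem rcWeight_cross_condition {p p' q : ℝ} (hp : p ∈ Set.Icc (0 : ℝ) 1) (hp' : p' ∈ Set.Icc (0 : ℝ) 1)
    (hpp : p ≤ p') (hq : 1 ≤ q) {W W' : Set V} (hW : W ⊆ W') (a b : Finset (Sym2 V)) :
    (if a ⊆ G.edgeFinset then rcWeight G p q W a else 0) * (if b ⊆ G.edgeFinset then rcWeight G p' q W' b else 0) ≤
      (if a ⊓ b ⊆ G.edgeFinset then rcWeight G p q W (a ⊓ b) else 0) *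
        (if a ⊔ b ⊆ G.edgeFinset then rcWeight G p' q W' (a ⊔ b) else 0) := by
  have hq0 : 0 ≤ q := zero_le_one.trans hq
  by_cases ha : a ⊆ G.edgeFinset
  swap
  · rw [if_neg ha, zero_mul]
    exact mul_nonneg (rcWeight_ite_nonneg G hp hq0 W _) (rcWeight_ite_nonneg G hp' hq0 W' _)
  by_cases hb : b ⊆ G.edgeFinset
  swap
  · rw [if_neg hb, mul_zero]
    exact mul_nonneg (rcWeight_ite_nonneg G hp hq0 W _) (rcWeight_ite_nonneg G hp' hq0 W' _)
  have hab : a ⊓ b ⊆ G.edgeFinset := (Finset.inter_subset_left).trans ha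
  have hab' : a ⊔ b ⊆ G.edgeFinset := Finset.union_subset ha hb
  rw [if_pos ha, if_pos hb, if_pos hab, if_pos hab']
  simp only [rcWeight, Finset.inf_eq_inter, Finset.sup_eq_union]
  set E := G.edgeFinset with hE
  set k := #(a \ b) with hk
  -- the exponents
  have hA : #(a \ b) + #(a ∩ b) = #a := Finset.card_sdiff_add_card_inter a b
  have hU : #(a \ b) + #b = #(a ∪ b) := Finset.card_sdiff_add_card a b
  have hEa : #(E \ a) + #a = #E := Finset.card_sdiff_add_card_eq_card ha
  have hEb : #(E \ b) + #b = #E := Finset.card_sdiff_add_card_eq_card hb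
  have hEab : #(E \ (a ∩ b)) + #(a ∩ b) = #E := Finset.card_sdiff_add_card_eq_card hab
  have hEaub : #(E \ (a ∪ b)) + #(a ∪ b) = #E := Finset.card_sdiff_add_card_eq_card hab'
  have e1 : #a = #(a ∩ b) + k := by omega
  have e2 : #(a ∪ b) = #b + k := by omega
  have e3 : #(E \ (a ∩ b)) = #(E \ a) + k := by omega
  have e4 : #(E \ b) = #(E \ (a ∪ b)) + k := by omega
  -- the cluster counts
  have hkk : clusterCount (↑a : BondConfig V) W + clusterCount (↑b : BondConfig V) W' ≤
      clusterCount (↑(a ∩ b) : BondConfig V) W + clusterCount (↑(a ∪ b) : BondConfig V) W' := by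
    rw [Finset.coe_inter, Finset.coe_union]
    exact clusterCount_cross _ _ hW
  have h0p : 0 ≤ p := hp.1
  have h1p : 0 ≤ 1 - p := sub_nonneg.2 hp.2
  have h0p' : 0 ≤ p' := hp'.1
  have h1p' : 0 ≤ 1 - p' := sub_nonneg.2 hp'.2
  have hq1 : 1 ≤ q := hq
  -- the key scalar inequality
  have key : (p * (1 - p')) ^ k * q ^ (clusterCount (↑a : BondConfig V) W + clusterCount (↑b : BondConfig V) W') ≤
      ((1 - p) * p') ^ k * q ^ (clusterCount (↑(a ∩ b) : BondConfig V) W + clusterCount (↑(a ∪ b) : BondConfig V) W') :=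
    mul_le_mul (pow_le_pow_left₀ (mul_nonneg h0p h1p') (by nlinarith) k) (pow_le_pow_right₀ hq1 hkk) (by positivity)
      (by positivity)
  set C := p ^ #(a ∩ b) * (1 - p) ^ #(E \ a) * p' ^ #b * (1 - p') ^ #(E \ (a ∪ b)) with hC
  have hC0 : 0 ≤ C := by positivity
  rw [e1, e2, e3, e4]
  calc p ^ (#(a ∩ b) + k) * (1 - p) ^ #(E \ a) * q ^ clusterCount (↑a : BondConfig V) W *
        (p' ^ #b * (1 - p') ^ (#(E \ (a ∪ b)) + k) * q ^ clusterCount (↑b : BondConfig V) W')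
      = C * ((p * (1 - p')) ^ k * q ^ (clusterCount (↑a : BondConfig V) W + clusterCount (↑b : BondConfig V) W')) := by
        simp only [hC, pow_add, mul_pow]; ring
    _ ≤ C * (((1 - p) * p') ^ k *
          q ^ (clusterCount (↑(a ∩ b) : BondConfig V) W + clusterCount (↑(a ∪ b) : BondConfig V) W')) :=
        mul_le_mul_of_nonneg_left key hC0
    _ = p ^ #(a ∩ b) * (1 - p) ^ (#(E \ a) + k) * q ^ clusterCount (↑(a ∩ b) : BondConfig V) W *
        (p' ^ (#b + k) * (1 - p') ^ #(E \ (a ∪ b)) * q ^ clusterCount (↑(a ∪ b) : BondConfig V) W') := by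
        simp only [hC, pow_add, mul_pow]; ring

/-- **Holley's condition for the random-cluster weights at `q ≤ q'`** (same `p ∈ [0,1]`, same wired set, `q ≥ 1`):
`w_{q'}(a) w_q(b) ≤ w_{q'}(a ∩ b) w_q(a ∪ b)` — more clusters are favoured by the larger `q`, so `φ_{p,q'}` lies BELOW
`φ_{p,q}`. [this work; cite: Grimmett2006, Thm. 3.21 (comparison inequalities, positive weights)] -/
theorem rcWeight_cross_condition_q {p q q' : ℝ} (hp : p ∈ Set.Icc (0 : ℝ) 1) (hq : 1 ≤ q) (hqq : q ≤ q') (W : Set V)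
    (a b : Finset (Sym2 V)) :
    (if a ⊆ G.edgeFinset then rcWeight G p q' W a else 0) * (if b ⊆ G.edgeFinset then rcWeight G p q W b else 0) ≤
      (if a ⊓ b ⊆ G.edgeFinset then rcWeight G p q' W (a ⊓ b) else 0) *
        (if a ⊔ b ⊆ G.edgeFinset then rcWeight G p q W (a ⊔ b) else 0) := by
  have hq0 : 0 ≤ q := zero_le_one.trans hq
  have hq'1 : 1 ≤ q' := hq.trans hqq
  have hq'0 : 0 ≤ q' := zero_le_one.trans hq'1
  by_cases ha : a ⊆ G.edgeFinset
  swap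
  · rw [if_neg ha, zero_mul]
    exact mul_nonneg (rcWeight_ite_nonneg G hp hq'0 W _) (rcWeight_ite_nonneg G hp hq0 W _)
  by_cases hb : b ⊆ G.edgeFinset
  swap
  · rw [if_neg hb, mul_zero]
    exact mul_nonneg (rcWeight_ite_nonneg G hp hq'0 W _) (rcWeight_ite_nonneg G hp hq0 W _)
  have hab : a ⊓ b ⊆ G.edgeFinset := (Finset.inter_subset_left).trans ha
  have hab' : a ⊔ b ⊆ G.edgeFinset := Finset.union_subset ha hb
  rw [if_pos ha, if_pos hb, if_pos hab, if_pos hab']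
  simp only [rcWeight, Finset.inf_eq_inter, Finset.sup_eq_union]
  set E := G.edgeFinset with hE
  have hcard : #a + #b = #(a ∩ b) + #(a ∪ b) := by
    rw [add_comm (#(a ∩ b)), Finset.card_union_add_card_inter]
  have hEa : #(E \ a) + #a = #E := Finset.card_sdiff_add_card_eq_card ha
  have hEb : #(E \ b) + #b = #E := Finset.card_sdiff_add_card_eq_card hb
  have hEab : #(E \ (a ∩ b)) + #(a ∩ b) = #E := Finset.card_sdiff_add_card_eq_card hab
  have hEaub : #(E \ (a ∪ b)) + #(a ∪ b) = #E := Finset.card_sdiff_add_card_eq_card hab'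
  have hcard' : #(E \ a) + #(E \ b) = #(E \ (a ∩ b)) + #(E \ (a ∪ b)) := by omega
  -- cluster counts: `k(a ∩ b) = k(a) + u`, `k(b) = k(a ∪ b) + v`, `v ≤ u`
  obtain ⟨u, hu⟩ : ∃ u, clusterCount (↑(a ∩ b) : BondConfig V) W = clusterCount (↑a : BondConfig V) W + u :=
    Nat.exists_eq_add_of_le (clusterCount_anti (by rw [Finset.coe_inter]; exact inter_subset_left) W)
  obtain ⟨v, hv⟩ : ∃ v, clusterCount (↑b : BondConfig V) W = clusterCount (↑(a ∪ b) : BondConfig V) W + v :=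
    Nat.exists_eq_add_of_le (clusterCount_anti (by rw [Finset.coe_union]; exact subset_union_right) W)
  have hsm : clusterCount (↑a : BondConfig V) W + clusterCount (↑b : BondConfig V) W ≤
      clusterCount (↑(a ∩ b) : BondConfig V) W + clusterCount (↑(a ∪ b) : BondConfig V) W := by
    rw [Finset.coe_inter, Finset.coe_union]
    exact clusterCount_supermodular _ _ W
  have hvu : v ≤ u := by omega
  have key : q ^ v ≤ q' ^ u := (pow_le_pow_left₀ hq0 hqq v).trans (pow_le_pow_right₀ hq'1 hvu)
  have h0p : 0 ≤ p := hp.1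
  have h1p : 0 ≤ 1 - p := sub_nonneg.2 hp.2
  set C := p ^ (#a + #b) * (1 - p) ^ (#(E \ a) + #(E \ b)) * q' ^ clusterCount (↑a : BondConfig V) W *
    q ^ clusterCount (↑(a ∪ b) : BondConfig V) W with hC
  have hC0 : 0 ≤ C := by positivity
  rw [hu, hv]
  calc p ^ #a * (1 - p) ^ #(E \ a) * q' ^ clusterCount (↑a : BondConfig V) W *
        (p ^ #b * (1 - p) ^ #(E \ b) * q ^ (clusterCount (↑(a ∪ b) : BondConfig V) W + v))
      = C * q ^ v := by simp only [hC, pow_add]; ring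
    _ ≤ C * q' ^ u := mul_le_mul_of_nonneg_left key hC0
    _ = p ^ (#a + #b) * (1 - p) ^ (#(E \ a) + #(E \ b)) * q' ^ (clusterCount (↑a : BondConfig V) W + u) *
        q ^ clusterCount (↑(a ∪ b) : BondConfig V) W := by simp only [hC, pow_add]; ring
    _ = p ^ #(a ∩ b) * (1 - p) ^ #(E \ (a ∩ b)) * q' ^ (clusterCount (↑a : BondConfig V) W + u) *
        (p ^ #(a ∪ b) * (1 - p) ^ #(E \ (a ∪ b)) * q ^ clusterCount (↑(a ∪ b) : BondConfig V) W) := by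
        rw [hcard, hcard']; simp only [pow_add]; ring

open scoped FinsetFamily in
/-- **The two-measure lattice inequality for events** of `φ₁ = φ^W_{G,p,q}`, `φ₂ = φ^{W'}_{G,p',q'}` whose weights
satisfy Holley's cross condition: if `s ∩ t ∈ S'` and `s ∪ t ∈ T'` whenever `s ∈ S`, `t ∈ T`, then
`φ₁(S) φ₂(T) ≤ φ₁(S') φ₂(T')` (four functions theorem). [this work] -/
theorem rcMeasure_real_mul_le_of_cross {p q p' q' : ℝ} (hp : p ∈ Set.Icc (0 : ℝ) 1) (hq : 0 < q)
    (hp' : p' ∈ Set.Icc (0 : ℝ) 1) (hq' : 0 < q') {W W' : Set V}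
    (hcross : ∀ a b : Finset (Sym2 V),
      (if a ⊆ G.edgeFinset then rcWeight G p q W a else 0) * (if b ⊆ G.edgeFinset then rcWeight G p' q' W' b else 0) ≤
        (if a ⊓ b ⊆ G.edgeFinset then rcWeight G p q W (a ⊓ b) else 0) *
          (if a ⊔ b ⊆ G.edgeFinset then rcWeight G p' q' W' (a ⊔ b) else 0))
    (S T S' T' : Set (BondConfig V)) (hinf : ∀ s ∈ S, ∀ t ∈ T, s ∩ t ∈ S') (hsup : ∀ s ∈ S, ∀ t ∈ T, s ∪ t ∈ T') :
    (rcMeasure G p q W).real S * (rcMeasure G p' q' W').real T ≤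
      (rcMeasure G p q W).real S' * (rcMeasure G p' q' W').real T' := by
  classical
  have hZ₁ := rcPartitionFunction_pos G hp hq W
  have hZ₂ := rcPartitionFunction_pos G hp' hq' W'
  set w₁ : Finset (Sym2 V) → ℝ := fun ω => if ω ⊆ G.edgeFinset then rcWeight G p q W ω else 0 with hw₁
  set w₂ : Finset (Sym2 V) → ℝ := fun ω => if ω ⊆ G.edgeFinset then rcWeight G p' q' W' ω else 0 with hw₂
  have hw₁0 : 0 ≤ w₁ := fun ω => rcWeight_ite_nonneg G hp hq.le W ω
  have hw₂0 : 0 ≤ w₂ := fun ω => rcWeight_ite_nonneg G hp' hq'.le W' ω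
  set F : Set (BondConfig V) → Finset (Finset (Sym2 V)) :=
    fun X => Finset.univ.filter fun ω : Finset (Sym2 V) => (↑ω : BondConfig V) ∈ X with hF
  have hreal₁ : ∀ X : Set (BondConfig V), (rcMeasure G p q W).real X = (∑ ω ∈ F X, w₁ ω) / rcPartitionFunction G p q W :=
    fun X => rcMeasure_real_eq_sum_filter G hp hq W X
  have hreal₂ : ∀ X : Set (BondConfig V),
      (rcMeasure G p' q' W').real X = (∑ ω ∈ F X, w₂ ω) / rcPartitionFunction G p' q' W' :=
    fun X => rcMeasure_real_eq_sum_filter G hp' hq' W' X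
  rw [hreal₁ S, hreal₂ T, hreal₁ S', hreal₂ T', div_mul_div_comm, div_mul_div_comm]
  refine div_le_div_of_nonneg_right ?_ (mul_pos hZ₁ hZ₂).le
  have h4 := four_functions_theorem w₁ w₂ w₁ w₂ hw₁0 hw₂0 hw₁0 hw₂0 hcross (F S) (F T)
  have hinfs : F S ⊼ F T ⊆ F S' := by
    intro c hc
    rw [Finset.mem_infs] at hc
    obtain ⟨a, ha, b, hb, rfl⟩ := hc
    simp only [hF, Finset.mem_filter, Finset.mem_univ, true_and] at ha hb ⊢
    rw [Finset.inf_eq_inter, Finset.coe_inter]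
    exact hinf _ ha _ hb
  have hsups : F S ⊻ F T ⊆ F T' := by
    intro c hc
    rw [Finset.mem_sups] at hc
    obtain ⟨a, ha, b, hb, rfl⟩ := hc
    simp only [hF, Finset.mem_filter, Finset.mem_univ, true_and] at ha hb ⊢
    rw [Finset.sup_eq_union, Finset.coe_union]
    exact hsup _ ha _ hb
  calc (∑ ω ∈ F S, w₁ ω) * ∑ ω ∈ F T, w₂ ω ≤ (∑ ω ∈ F S ⊼ F T, w₁ ω) * ∑ ω ∈ F S ⊻ F T, w₂ ω := h4
    _ ≤ (∑ ω ∈ F S', w₁ ω) * ∑ ω ∈ F T', w₂ ω :=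
        mul_le_mul (Finset.sum_le_sum_of_subset_of_nonneg hinfs fun ω _ _ => hw₁0 ω)
          (Finset.sum_le_sum_of_subset_of_nonneg hsups fun ω _ _ => hw₂0 ω)
          (Finset.sum_nonneg fun ω _ => hw₂0 ω) (Finset.sum_nonneg fun ω _ => hw₁0 ω)

/-- Two-measure real-to-`ℝ≥0∞` plumbing. [folklore] -/
theorem measure_mul_le_of_real_mul_le₂ {Ω : Type*} [MeasurableSpace Ω] (μ ν : Measure Ω) [IsFiniteMeasure μ]
    [IsFiniteMeasure ν] {S T S' T' : Set Ω} (h : μ.real S * ν.real T ≤ μ.real S' * ν.real T') :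
    μ S * ν T ≤ μ S' * ν T' := by
  rw [← ofReal_measureReal (measure_ne_top μ S), ← ofReal_measureReal (measure_ne_top ν T),
    ← ofReal_measureReal (measure_ne_top μ S'), ← ofReal_measureReal (measure_ne_top ν T'),
    ← ENNReal.ofReal_mul measureReal_nonneg, ← ENNReal.ofReal_mul measureReal_nonneg]
  exact ENNReal.ofReal_le_ofReal h

/-- **The cross box condition for two random-cluster measures whose weights satisfy Holley's cross condition.**
[this work] -/
theorem crossBox_rcMeasure_of_cross {p q p' q' : ℝ} (hp : p ∈ Set.Icc (0 : ℝ) 1) (hq : 0 < q)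
    (hp' : p' ∈ Set.Icc (0 : ℝ) 1) (hq' : 0 < q') {W W' : Set V}
    (hcross : ∀ a b : Finset (Sym2 V),
      (if a ⊆ G.edgeFinset then rcWeight G p q W a else 0) * (if b ⊆ G.edgeFinset then rcWeight G p' q' W' b else 0) ≤
        (if a ⊓ b ⊆ G.edgeFinset then rcWeight G p q W (a ⊓ b) else 0) *
          (if a ⊔ b ⊆ G.edgeFinset then rcWeight G p' q' W' (a ⊔ b) else 0))
    (a b a' b' : BondConfig V) :
    rcMeasure G p q W (Icc a b) * rcMeasure G p' q' W' (Icc a' b') ≤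
      rcMeasure G p q W (Icc (a ⊓ a') (b ⊓ b')) * rcMeasure G p' q' W' (Icc (a ⊔ a') (b ⊔ b')) := by
  haveI := isProbabilityMeasure_rcMeasure G hp hq W
  haveI := isProbabilityMeasure_rcMeasure G hp' hq' W'
  refine measure_mul_le_of_real_mul_le₂ _ _ (rcMeasure_real_mul_le_of_cross G hp hq hp' hq' hcross _ _ _ _ ?_ ?_)
  · intro s hs t ht
    exact ⟨subset_inter (inter_subset_left.trans hs.1) (inter_subset_right.trans ht.1), inter_subset_inter hs.2 ht.2⟩
  · intro s hs t ht
    exact ⟨union_subset_union hs.1 ht.1, union_subset (hs.2.trans subset_union_left) (ht.2.trans subset_union_right)⟩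

/-- **The cross box condition for `φ^W_{G,p,q}, φ^{W'}_{G,p',q}`** (`p ≤ p'`, `W ⊆ W'`, `q ≥ 1`). [this work] -/
theorem crossBox_rcMeasure {p p' q : ℝ} (hp : p ∈ Set.Icc (0 : ℝ) 1) (hp' : p' ∈ Set.Icc (0 : ℝ) 1) (hpp : p ≤ p')
    (hq : 1 ≤ q) {W W' : Set V} (hW : W ⊆ W') (a b a' b' : BondConfig V) :
    rcMeasure G p q W (Icc a b) * rcMeasure G p' q W' (Icc a' b') ≤
      rcMeasure G p q W (Icc (a ⊓ a') (b ⊓ b')) * rcMeasure G p' q W' (Icc (a ⊔ a') (b ⊔ b')) :=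
  crossBox_rcMeasure_of_cross G hp (one_pos.trans_le hq) hp' (one_pos.trans_le hq)
    (fun x y => rcWeight_cross_condition G hp hp' hpp hq hW x y) a b a' b'

/-- **The cross box condition for `φ^W_{G,p,q'}, φ^W_{G,p,q}`** (`1 ≤ q ≤ q'`): `φ_{p,q'}` below `φ_{p,q}`. [this work] -/
theorem crossBox_rcMeasure_q {p q q' : ℝ} (hp : p ∈ Set.Icc (0 : ℝ) 1) (hq : 1 ≤ q) (hqq : q ≤ q') (W : Set V)
    (a b a' b' : BondConfig V) :
    rcMeasure G p q' W (Icc a b) * rcMeasure G p q W (Icc a' b') ≤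
      rcMeasure G p q' W (Icc (a ⊓ a') (b ⊓ b')) * rcMeasure G p q W (Icc (a ⊔ a') (b ⊔ b')) :=
  crossBox_rcMeasure_of_cross G hp (one_pos.trans_le (hq.trans hqq)) hp (one_pos.trans_le hq)
    (fun x y => rcWeight_cross_condition_q G hp hq hqq W x y) a b a' b'

end Weights

/-! ### `ℤ^d`: the finite-region laws and their limits -/

section Lattice

variable {d : ℕ}

/-- **The cross box condition for two finite-region laws read on `ℤ^d` whose weights satisfy Holley's cross
condition.** [this work] -/
theorem crossBox_rcLaw_of_cross {p q p' q' : ℝ} (hp : p ∈ Set.Icc (0 : ℝ) 1) (hq : 0 < q)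
    (hp' : p' ∈ Set.Icc (0 : ℝ) 1) (hq' : 0 < q') (Λ : Finset (Site d)) {W W' : Set ↥Λ}
    (hcross : ∀ x y : Finset (Sym2 ↥Λ),
      (if x ⊆ (finsetGraph (zdGraph d) Λ).edgeFinset then rcWeight (finsetGraph (zdGraph d) Λ) p q W x else 0) *
          (if y ⊆ (finsetGraph (zdGraph d) Λ).edgeFinset then rcWeight (finsetGraph (zdGraph d) Λ) p' q' W' y else 0) ≤
        (if x ⊓ y ⊆ (finsetGraph (zdGraph d) Λ).edgeFinset then rcWeight (finsetGraph (zdGraph d) Λ) p q W (x ⊓ y) else 0) *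
          (if x ⊔ y ⊆ (finsetGraph (zdGraph d) Λ).edgeFinset then
            rcWeight (finsetGraph (zdGraph d) Λ) p' q' W' (x ⊔ y) else 0))
    (a b a' b' : BondConfig (Site d)) :
    rcLaw d p q Λ W (Icc a b) * rcLaw d p' q' Λ W' (Icc a' b') ≤
      rcLaw d p q Λ W (Icc (a ⊓ a') (b ⊓ b')) * rcLaw d p' q' Λ W' (Icc (a ⊔ a') (b ⊔ b')) := by
  classical
  haveI := isProbabilityMeasure_rcLaw (d := d) hp hq Λ W
  haveI := isProbabilityMeasure_rcLaw (d := d) hp' hq' Λ W'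
  refine measure_mul_le_of_real_mul_le₂ _ _ ?_
  rw [rcLaw_real_apply p q Λ W (measurableSet_Icc_set a b), rcLaw_real_apply p' q' Λ W' (measurableSet_Icc_set a' b'),
    rcLaw_real_apply p q Λ W (measurableSet_Icc_set _ _), rcLaw_real_apply p' q' Λ W' (measurableSet_Icc_set _ _)]
  refine rcMeasure_real_mul_le_of_cross _ hp hq hp' hq' hcross _ _ _ _ (fun s hs t ht => ?_) fun s hs t ht => ?_
  · change toLattice Λ (s ∩ t) ∈ Icc (a ⊓ a') (b ⊓ b')
    rw [toLattice_inter]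
    exact ⟨subset_inter (inter_subset_left.trans hs.1) (inter_subset_right.trans ht.1), inter_subset_inter hs.2 ht.2⟩
  · change toLattice Λ (s ∪ t) ∈ Icc (a ⊔ a') (b ⊔ b')
    rw [toLattice_union]
    exact ⟨union_subset_union hs.1 ht.1, union_subset (hs.2.trans subset_union_left) (ht.2.trans subset_union_right)⟩

/-- **The cross box condition for `φ^W_{Λ,p,q}, φ^{W'}_{Λ,p',q}` read on `ℤ^d`** (`p ≤ p'`, `W ⊆ W'`, `q ≥ 1`).
[this work] -/
theorem crossBox_rcLaw {p p' q : ℝ} (hp : p ∈ Set.Icc (0 : ℝ) 1) (hp' : p' ∈ Set.Icc (0 : ℝ) 1) (hpp : p ≤ p')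
    (hq : 1 ≤ q) (Λ : Finset (Site d)) {W W' : Set ↥Λ} (hW : W ⊆ W') (a b a' b' : BondConfig (Site d)) :
    rcLaw d p q Λ W (Icc a b) * rcLaw d p' q Λ W' (Icc a' b') ≤
      rcLaw d p q Λ W (Icc (a ⊓ a') (b ⊓ b')) * rcLaw d p' q Λ W' (Icc (a ⊔ a') (b ⊔ b')) :=
  crossBox_rcLaw_of_cross hp (one_pos.trans_le hq) hp' (one_pos.trans_le hq) Λ
    (fun x y => rcWeight_cross_condition _ hp hp' hpp hq hW x y) a b a' b'

/-- **The cross box condition for `φ^W_{Λ,p,q'}, φ^W_{Λ,p,q}` read on `ℤ^d`** (`1 ≤ q ≤ q'`). [this work] -/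
theorem crossBox_rcLaw_q {p q q' : ℝ} (hp : p ∈ Set.Icc (0 : ℝ) 1) (hq : 1 ≤ q) (hqq : q ≤ q') (Λ : Finset (Site d))
    (W : Set ↥Λ) (a b a' b' : BondConfig (Site d)) :
    rcLaw d p q' Λ W (Icc a b) * rcLaw d p q Λ W (Icc a' b') ≤
      rcLaw d p q' Λ W (Icc (a ⊓ a') (b ⊓ b')) * rcLaw d p q Λ W (Icc (a ⊔ a') (b ⊔ b')) :=
  crossBox_rcLaw_of_cross hp (one_pos.trans_le (hq.trans hqq)) hp (one_pos.trans_le hq) Λ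
    (fun x y => rcWeight_cross_condition_q _ hp hq hqq W x y) a b a' b'

/-- The wired vertex sets are ordered: `free ≤ wired`. [folklore] -/
theorem RCBoundary.wiredSet_free_subset (b : RCBoundary) (Λ : Finset (Site d)) :
    RCBoundary.free.wiredSet Λ ⊆ b.wiredSet Λ := fun x hx => by cases hx

/-- Reflexive case. [folklore] -/
theorem RCBoundary.wiredSet_subset_wired (b : RCBoundary) (Λ : Finset (Site d)) :
    b.wiredSet Λ ⊆ RCBoundary.wired.wiredSet Λ := by
  cases b
  · exact RCBoundary.wiredSet_free_subset _ Λ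
  · exact subset_rfl

end Lattice

end Summit.CriticalPhenomena.PercolationContinuityZ3.Theorems.SahiBoxTP2
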